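import Literature.NumberTheory.EllipticCurves.IwasawaTwistModP
import HarnessLib

/-!
# The `T`-adic tower `(H¹(K, 𝒯_J))_J` of the mod-`(p, T^J)` Iwasawa twists: the shift `T` on
# cohomology, `T^J = 0` at level `J`, the inverse limit `𝐇¹_Ω = lim←_J H¹(K, 𝒯_J)`, its
# `T`-adic separatedness and the order `ord_T` of a non-zero class (definitions + proofs; no fact)

Topic `NumberTheory/EllipticCurves` (sequel of `IwasawaTwistModP`); namespace
`Literature.NumberTheory.EllipticCurves.ZpExtension`.  Cell `bsd-smallim` (rung K6 of
`BirchSwinnertonDyer`, class X9, crux `MuTransferX9` = item 19276, registered stub `stub_coreX9`),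
seat `bsd-smallim-k6-c2` (gen 2), CORE-PLAN §1 (S0.2–S0.3): the "Step 0" objects of the cell's Theorem A
(HOME/koly/MU-TRANSFER-PROOF.md (F4): "`𝐳̄_1 = T^a κ'` with `κ'` indivisible by `T`") in the FUNCTORIAL
currency of `κ.twistModP ρ hM J` (= `𝒯_J = M ⊗ 𝔽_p[T]/(T^J)(χ_κ)`), where no transfer/corestriction and
no Shapiro lemma is needed:

* `twistModPShift` — multiplication by `T` (the shift `S`) as a `Γ_K`-equivariant continuous map
  `𝒯_J → 𝒯_J` (`shiftEnd_twistModP_apply`), and `shiftH1 J` = the induced endomorphism `T` of `H¹(K, 𝒯_J)`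
  (`galoisCohomology.map`); on classes `T[φ] = [S ∘ φ]` (`shiftH1_oneCocycleClass`), iterates
  `T^[k][φ] = [S^k ∘ φ]`, hence **`T^[J] = 0` on `H¹(K, 𝒯_J)`** (`shiftH1_iterate_eq_zero`, from `S^J = 0`).
* `truncH1 h` — `H¹(K, 𝒯_J) → H¹(K, 𝒯_{J'})` (`J' ≤ J`) induced by truncation; `truncH1 ∘ shiftH1 =
  shiftH1 ∘ truncH1` (`truncH1_shiftH1`, coordinatewise); `truncH1` transitive (`truncH1_truncH1`).
* `twistTower ρ hM` — the inverse limit `𝐇¹_Ω := lim←_J H¹(K, 𝒯_J)` written inside `∏_J H¹(K, 𝒯_J)`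
  (compatible families), an additive subgroup; `towerShift` = `T` on it (levelwise `shiftH1`).
* **Separatedness** `towerShift_iterate_eq_self_imp` / `eq_zero_of_forall_exists_iterate`: a family
  divisible by every power of `T` is `0` (at level `J`, `T^[J] = 0`); and **`ord_T`**:
  `exists_iterate_eq_and_not_exists` — every `x ≠ 0` is `T^[a] y` with `y ∉ T·𝐇¹_Ω` for a (unique) `a`.
  This is (F4)'s factorisation WITHOUT the freeness of `H¹(G_S, 𝒯)` over `Ω` (not needed).
* `towerConst` — reduction mod `T`: `𝐇¹_Ω → H¹(K, M)` through the constant coefficient at level `1`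
  (`twistModPConstCoeff`), killing `T·𝐇¹_Ω` (`towerConst_towerShift`).

Not here (CORE-PLAN S0.4–S0.6, S2.1): the reduction `𝐇¹_Γ(T_pW) → 𝐇¹_Ω` from the Λ-adic pin
(`Kato2004.IwasawaH1Data`) and its kernel `p·𝐇¹`; the exactness `ker(towerConst) = T·𝐇¹_Ω` (long exact
sequence of `0 → 𝒯_J →S 𝒯_{J+1} → M → 0` plus `M^{Γ_K} = 0`); Shapiro `H¹(K, 𝒯_{p^n}) ≅ H¹(K_n, M)`.
HONEST FRAMING: definitions with bodies and theorems; nothing asserted; BSD is not advanced.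

References: B. Mazur, K. Rubin, *Kolyvagin systems*, Mem. AMS 799 (2004) §5.3 (the modules `T ⊗ Λ/𝔪^k`
and their cohomology along `k`) [MazurRubin2004]; L. Washington, *Introduction to Cyclotomic Fields*,
§13.1–13.2 [Washington1997]; J.-P. Serre, *Galois Cohomology* I §2.2 (functoriality) [SerreGaloisCohomology1997];
HOME/koly/MU-TRANSFER-PROOF.md (F4).
-/

noncomputable section

open scoped ContRepresentation
open Field Filter

universe u

namespace Literature.NumberTheory.EllipticCurves

open Literature.NumberTheory.GaloisRepresentations

namespace ZpExtension

variable {K : Type u} [Field K] {p : ℕ} [Fact p.Prime] (κ : ZpExtension K p)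
  {M : Type u} [AddCommGroup M] [TopologicalSpace M] [DiscreteTopology M]
  (ρ : DiscreteGaloisModule K M) (hM : ∀ x : M, p • x = 0) (J : ℕ)

/-! ## The shift `T : 𝒯_J → 𝒯_J` as an equivariant map, and `T` on `H¹(K, 𝒯_J)` -/

/-- **Multiplication by `T` on `𝒯_J = M ⊗ 𝔽_p[T]/(T^J)(χ_κ)`** (the shift `S`) as a continuous
`Γ_K`-equivariant map (`shiftEnd_twistModP_apply`), usable in `galoisCohomology.map`.
[cite: Washington1997, §13.1–§13.2] -/
def twistModPShift :
    (κ.twistModP ρ hM J).toContRepresentation →ⁱL (κ.twistModP ρ hM J).toContRepresentation where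
  toContinuousLinearMap :=
    { toFun := shiftEnd M J
      map_add' := map_add _
      map_smul' := fun c x => by rw [map_zsmul, RingHom.id_apply]
      cont := continuous_of_discreteTopology }
  isIntertwining' g := by
    refine ContinuousLinearMap.ext fun x => ?_
    exact shiftEnd_twistModP_apply κ ρ hM J g x

/-- Unfolding lemma for `twistModPShift`. [cite: Washington1997, §13.1–§13.2] -/
@[simp] theorem twistModPShift_apply (x : Fin J → M) : κ.twistModPShift ρ hM J x = shiftEnd M J x := rfl

/-- **`T` on `H¹(K, 𝒯_J)`**: the endomorphism induced by the shift (functoriality of `H¹(K, –)`).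
[cite: SerreGaloisCohomology1997, I §2.2] -/
def shiftH1 : galoisCohomology (κ.twistModP ρ hM J) 1 →+ galoisCohomology (κ.twistModP ρ hM J) 1 :=
  galoisCohomology.map (κ.twistModPShift ρ hM J) 1

variable {J} in
/-- **Truncation on `H¹`**: `H¹(K, 𝒯_J) → H¹(K, 𝒯_{J'})` for `J' ≤ J` (functoriality along
`twistModPTruncate`). [cite: SerreGaloisCohomology1997, I §2.2] -/
def truncH1 {J' : ℕ} (h : J' ≤ J) :
    galoisCohomology (κ.twistModP ρ hM J) 1 →+ galoisCohomology (κ.twistModP ρ hM J') 1 :=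
  galoisCohomology.map (κ.twistModPTruncate ρ hM J h) 1

/-! ### Cocycle-level descriptions (any equivariant coordinate map out of a twist) -/

section Push

variable {N : Type u} [AddCommGroup N] [TopologicalSpace N] [DiscreteTopology N]
  {ρ' : DiscreteGaloisModule K N}

/-- The crossed homomorphism `f ∘ φ` for an equivariant continuous map `f` out of `𝒯_J`
(`contOneCocycles.pullback` along the identity of `Γ_K`). [cite: SerreGaloisCohomology1997, I §2.2] -/
abbrev pushCocycle (f : (κ.twistModP ρ hM J).toContRepresentation →ⁱL ρ'.toContRepresentation)
    (φ : contOneCocycles (κ.twistModP ρ hM J).toTopRep) : contOneCocycles ρ'.toTopRep :=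
  contOneCocycles.pullback (ContinuousMonoidHom.id (absoluteGaloisGroup K))
    (X := (κ.twistModP ρ hM J).toTopRep) (Y := ρ'.toTopRep)
    (TopRep.ofHom ⟨f.toContinuousLinearMap, f.isIntertwining'⟩) φ

/-- Values of `pushCocycle f φ`: `(f ∘ φ)(σ) = f (φ σ)`. [cite: SerreGaloisCohomology1997, I §2.2] -/
@[simp] theorem pushCocycle_apply
    (f : (κ.twistModP ρ hM J).toContRepresentation →ⁱL ρ'.toContRepresentation)
    (φ : contOneCocycles (κ.twistModP ρ hM J).toTopRep) (σ : absoluteGaloisGroup K) :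
    (κ.pushCocycle ρ hM J f φ).1 σ = f (φ.1 σ) := rfl

/-- `H¹(f)[φ] = [f ∘ φ]` for an equivariant continuous map out of a twist.
[cite: SerreGaloisCohomology1997, I §2.2] -/
theorem map_oneCocycleClass_twist
    (f : (κ.twistModP ρ hM J).toContRepresentation →ⁱL ρ'.toContRepresentation)
    (φ : contOneCocycles (κ.twistModP ρ hM J).toTopRep) :
    galoisCohomology.map f 1 (oneCocycleClass (κ.twistModP ρ hM J).toTopRep φ) =
      oneCocycleClass ρ'.toTopRep (κ.pushCocycle ρ hM J f φ) :=
  map_oneCocycleClass _ _ _ φ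

/-- The class of a push is `0` as soon as the pushed cocycle vanishes identically.
[cite: SerreGaloisCohomology1997, I §2.2] -/
theorem oneCocycleClass_push_eq_zero_of_forall
    (f : (κ.twistModP ρ hM J).toContRepresentation →ⁱL ρ'.toContRepresentation)
    (φ : contOneCocycles (κ.twistModP ρ hM J).toTopRep) (h : ∀ σ, f (φ.1 σ) = 0) :
    (oneCocycleClass ρ'.toTopRep (κ.pushCocycle ρ hM J f φ) : galoisCohomology ρ' 1) = 0 :=
  (oneCocycleClass_eq_zero_iff _ _).mpr ⟨0, fun σ => by rw [pushCocycle_apply, h, map_zero, sub_zero]⟩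

/-- Two equivariant maps with the same underlying function induce the same map on `H¹`.
[cite: SerreGaloisCohomology1997, I §2.2] -/
theorem map_eq_map_of_coe_eq (f g : (κ.twistModP ρ hM J).toContRepresentation →ⁱL ρ'.toContRepresentation)
    (hfg : ∀ x, f x = g x) (c : galoisCohomology (κ.twistModP ρ hM J) 1) :
    galoisCohomology.map f 1 c = galoisCohomology.map g 1 c := by
  obtain ⟨φ, rfl⟩ := oneCocycleClass_surjective _ c
  rw [map_oneCocycleClass_twist, map_oneCocycleClass_twist]
  congr 1
  exact Subtype.ext (ContinuousMap.ext fun σ => hfg _)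

/-- If an equivariant map is zero, so is the induced map on `H¹`.
[cite: SerreGaloisCohomology1997, I §2.2] -/
theorem map_eq_zero_of_coe_eq_zero (f : (κ.twistModP ρ hM J).toContRepresentation →ⁱL ρ'.toContRepresentation)
    (hf : ∀ x, f x = 0) (c : galoisCohomology (κ.twistModP ρ hM J) 1) :
    galoisCohomology.map f 1 c = 0 := by
  obtain ⟨φ, rfl⟩ := oneCocycleClass_surjective _ c
  rw [map_oneCocycleClass_twist]
  exact κ.oneCocycleClass_push_eq_zero_of_forall ρ hM J f φ fun σ => hf _

end Push

/-- `H¹` of a composite of equivariant coordinate maps between twists is the composite (checked on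
classes). [cite: SerreGaloisCohomology1997, I §2.2] -/
theorem map_map_twist {J' J'' : ℕ}
    (f : (κ.twistModP ρ hM J).toContRepresentation →ⁱL (κ.twistModP ρ hM J').toContRepresentation)
    (g : (κ.twistModP ρ hM J').toContRepresentation →ⁱL (κ.twistModP ρ hM J'').toContRepresentation)
    (h : (κ.twistModP ρ hM J).toContRepresentation →ⁱL (κ.twistModP ρ hM J'').toContRepresentation)
    (hcomp : ∀ x, h x = g (f x)) (c : galoisCohomology (κ.twistModP ρ hM J) 1) :
    galoisCohomology.map g 1 (galoisCohomology.map f 1 c) = galoisCohomology.map h 1 c := by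
  obtain ⟨φ, rfl⟩ := oneCocycleClass_surjective _ c
  rw [map_oneCocycleClass_twist, map_oneCocycleClass_twist, map_oneCocycleClass_twist]
  congr 1
  exact Subtype.ext (ContinuousMap.ext fun σ => (hcomp _).symm)

/-! ### `T^[J] = 0` on `H¹(K, 𝒯_J)`; `T` commutes with truncation -/

/-- The cocycle `S^k ∘ φ`. [cite: Washington1997, §13.1–§13.2] -/
def shiftPowCocycle (k : ℕ) (φ : contOneCocycles (κ.twistModP ρ hM J).toTopRep) :
    contOneCocycles (κ.twistModP ρ hM J).toTopRep :=
  ⟨⟨fun σ => (shiftEnd M J ^ k) (φ.1 σ), continuous_of_discreteTopology.comp φ.1.continuous⟩, by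
    intro g h
    change (shiftEnd M J ^ k) (φ.1 (g * h)) =
      (shiftEnd M J ^ k) (φ.1 g) + κ.twistModP ρ hM J g ((shiftEnd M J ^ k) (φ.1 h))
    rw [φ.2 g h, map_add]
    congr 1
    change (shiftEnd M J ^ k) (κ.twistModP ρ hM J g (φ.1 h)) = _
    induction k with
    | zero => rfl
    | succ k ih =>
      simp only [pow_succ', Module.End.mul_apply]
      rw [ih, shiftEnd_twistModP_apply]⟩

/-- Values of `shiftPowCocycle`. [cite: Washington1997, §13.1–§13.2] -/
@[simp] theorem shiftPowCocycle_apply (k : ℕ) (φ : contOneCocycles (κ.twistModP ρ hM J).toTopRep)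
    (σ : absoluteGaloisGroup K) : (κ.shiftPowCocycle ρ hM J k φ).1 σ = (shiftEnd M J ^ k) (φ.1 σ) := rfl

/-- On classes, `T^[k] [φ] = [S^k ∘ φ]`. [cite: Washington1997, §13.1–§13.2] -/
theorem shiftH1_iterate_oneCocycleClass (k : ℕ) (φ : contOneCocycles (κ.twistModP ρ hM J).toTopRep) :
    (κ.shiftH1 ρ hM J)^[k] (oneCocycleClass _ φ) =
      oneCocycleClass (κ.twistModP ρ hM J).toTopRep (κ.shiftPowCocycle ρ hM J k φ) := by
  induction k with
  | zero =>
    rw [Function.iterate_zero, id_eq]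
    exact congrArg _ (Subtype.ext (ContinuousMap.ext fun σ => rfl))
  | succ k ih =>
    rw [Function.iterate_succ_apply', ih, shiftH1, map_oneCocycleClass_twist]
    congr 1
    refine Subtype.ext (ContinuousMap.ext fun σ => ?_)
    change κ.twistModPShift ρ hM J ((shiftEnd M J ^ k) (φ.1 σ)) = (shiftEnd M J ^ (k + 1)) (φ.1 σ)
    rw [twistModPShift_apply, pow_succ', Module.End.mul_apply]

/-- **`T^[k] = 0` on `H¹(K, 𝒯_J)` for `k ≥ J`** (`S^J = 0` on `𝒯_J`): every class of the `J`-th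
level is killed by the `J`-th iterate of the shift. [cite: Washington1997, §13.1–§13.2] -/
theorem shiftH1_iterate_eq_zero {k : ℕ} (hk : J ≤ k) (c : galoisCohomology (κ.twistModP ρ hM J) 1) :
    (κ.shiftH1 ρ hM J)^[k] c = 0 := by
  obtain ⟨φ, rfl⟩ := oneCocycleClass_surjective _ c
  rw [shiftH1_iterate_oneCocycleClass]
  refine (oneCocycleClass_eq_zero_iff _ _).mpr ⟨0, fun σ => ?_⟩
  rw [shiftPowCocycle_apply, shiftEnd_pow_eq_zero hk, LinearMap.zero_apply, map_zero, sub_zero]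

variable {J} in
/-- **`T` commutes with truncation** on `H¹` (`J' ≤ J`): both composites are induced by the same
coordinate map `x ↦ S (x mod T^{J'}) = (S x) mod T^{J'}`. [cite: Washington1997, §13.1–§13.2] -/
theorem truncH1_shiftH1 {J' : ℕ} (h : J' ≤ J) (c : galoisCohomology (κ.twistModP ρ hM J) 1) :
    κ.truncH1 ρ hM h (κ.shiftH1 ρ hM J c) = κ.shiftH1 ρ hM J' (κ.truncH1 ρ hM h c) := by
  unfold truncH1 shiftH1
  rw [map_map_twist κ ρ hM J _ _ ((κ.twistModPTruncate ρ hM J h).comp (κ.twistModPShift ρ hM J))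
      (fun _ => rfl),
    map_map_twist κ ρ hM J _ _ ((κ.twistModPShift ρ hM J').comp (κ.twistModPTruncate ρ hM J h))
      (fun _ => rfl)]
  refine κ.map_eq_map_of_coe_eq ρ hM J _ _ (fun x => ?_) c
  change κ.twistModPTruncate ρ hM J h (shiftEnd M J x) = shiftEnd M J' (κ.twistModPTruncate ρ hM J h x)
  funext i
  by_cases hi : (i : ℕ) = 0
  · simp [twistModPTruncate_apply, shiftEnd_apply, hi]
  · simp [twistModPTruncate_apply, shiftEnd_apply, hi]

variable {J} in
/-- Truncation is transitive on `H¹`. [cite: Washington1997, §13.1–§13.2] -/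
theorem truncH1_truncH1 {J' J'' : ℕ} (h : J' ≤ J) (h' : J'' ≤ J')
    (c : galoisCohomology (κ.twistModP ρ hM J) 1) :
    κ.truncH1 ρ hM h' (κ.truncH1 ρ hM h c) = κ.truncH1 ρ hM (h'.trans h) c := by
  unfold truncH1
  exact κ.map_map_twist ρ hM J _ _ _ (fun _ => rfl) c

/-- Truncation along `le_refl` is the identity on `H¹`. [cite: Washington1997, §13.1–§13.2] -/
theorem truncH1_refl (c : galoisCohomology (κ.twistModP ρ hM J) 1) : κ.truncH1 ρ hM le_rfl c = c := by
  obtain ⟨φ, rfl⟩ := oneCocycleClass_surjective _ c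
  unfold truncH1
  rw [map_oneCocycleClass_twist]
  exact congrArg _ (Subtype.ext (ContinuousMap.ext fun σ => funext fun i => rfl))

/-! ## The inverse limit `𝐇¹_Ω = lim←_J H¹(K, 𝒯_J)` and its `T`-adic structure -/

/-- **`𝐇¹_Ω := lim←_J H¹(K, 𝒯_J)`**, the compatible families in `∏_J H¹(K, 𝒯_J)` under truncation —
Galois cohomology with `Ω = 𝔽_p⟦T⟧`-adic coefficients `𝒯 = M ⊗ Ω(χ_κ)` written levelwise
(MU-TRANSFER-PROOF (F4): `𝐇¹_Ω = H¹(G, 𝒯)`; Mazur–Rubin §5.3). [cite: MazurRubin2004, §5.3] -/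
def twistTower : AddSubgroup (∀ J : ℕ, galoisCohomology (κ.twistModP ρ hM J) 1) where
  carrier := {x | ∀ (J J' : ℕ) (h : J' ≤ J), κ.truncH1 ρ hM h (x J) = x J'}
  zero_mem' := fun J J' h => by simp only [Pi.zero_apply, map_zero]
  add_mem' := fun {x y} hx hy J J' h => by simp only [Pi.add_apply, map_add, hx J J' h, hy J J' h]
  neg_mem' := fun {x} hx J J' h => by simp only [Pi.neg_apply, map_neg, hx J J' h]

/-- Membership in `twistTower`: compatibility under all truncations. [cite: MazurRubin2004, §5.3] -/
theorem mem_twistTower_iff (x : ∀ J : ℕ, galoisCohomology (κ.twistModP ρ hM J) 1) :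
    x ∈ κ.twistTower ρ hM ↔ ∀ (J J' : ℕ) (h : J' ≤ J), κ.truncH1 ρ hM h (x J) = x J' := Iff.rfl

/-- **`T` on `𝐇¹_Ω`**: the levelwise shift (it preserves compatible families by `truncH1_shiftH1`).
[cite: MazurRubin2004, §5.3] -/
def towerShift : κ.twistTower ρ hM →+ κ.twistTower ρ hM where
  toFun x := ⟨fun J => κ.shiftH1 ρ hM J (x.1 J), fun J J' h => by
    rw [truncH1_shiftH1, x.2 J J' h]⟩
  map_zero' := Subtype.ext (funext fun J => by
    change κ.shiftH1 ρ hM J ((0 : κ.twistTower ρ hM).1 J) = 0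
    rw [ZeroMemClass.coe_zero, Pi.zero_apply, map_zero])
  map_add' x y := Subtype.ext (funext fun J => by
    change κ.shiftH1 ρ hM J ((x + y).1 J) = κ.shiftH1 ρ hM J (x.1 J) + κ.shiftH1 ρ hM J (y.1 J)
    rw [AddMemClass.coe_add, Pi.add_apply, map_add])

/-- Components of `towerShift`. [cite: MazurRubin2004, §5.3] -/
@[simp] theorem towerShift_apply_coe (x : κ.twistTower ρ hM) (J : ℕ) :
    (κ.towerShift ρ hM x).1 J = κ.shiftH1 ρ hM J (x.1 J) := rfl

/-- Components of the iterates of `towerShift`. [cite: MazurRubin2004, §5.3] -/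
theorem towerShift_iterate_apply_coe (k : ℕ) (x : κ.twistTower ρ hM) (J : ℕ) :
    ((κ.towerShift ρ hM)^[k] x).1 J = (κ.shiftH1 ρ hM J)^[k] (x.1 J) := by
  induction k generalizing x with
  | zero => rfl
  | succ k ih => rw [Function.iterate_succ_apply, Function.iterate_succ_apply, ih, towerShift_apply_coe]

/-- **`T`-adic separatedness of `𝐇¹_Ω`**: a compatible family divisible by every power of `T` is zero
(at level `J` it lies in `T^[J] H¹(K, 𝒯_J) = 0`). [cite: MazurRubin2004, §5.3] -/
theorem eq_zero_of_forall_exists_iterate (x : κ.twistTower ρ hM)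
    (hx : ∀ a : ℕ, ∃ y : κ.twistTower ρ hM, (κ.towerShift ρ hM)^[a] y = x) : x = 0 := by
  refine Subtype.ext (funext fun J => ?_)
  obtain ⟨y, hy⟩ := hx J
  rw [← hy, towerShift_iterate_apply_coe]
  exact κ.shiftH1_iterate_eq_zero ρ hM J le_rfl _

/-- **`ord_T` of a non-zero element of `𝐇¹_Ω`** (MU-TRANSFER-PROOF (F4): "`𝐳̄_1 = T^a κ'` with `κ'`
indivisible by `T`"): every `x ≠ 0` is `T^[a] y` for some `a` and some `y` that is NOT in the image of
`T`.  Proof: the set of `a` with `x ∈ T^[a] 𝐇¹_Ω` contains `0` and is bounded by any level `J` with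
`x_J ≠ 0` (since `T^[J] = 0` there); take its maximum (`Nat.findGreatest`).  No freeness of `𝐇¹_Ω` is
used. [cite: MazurRubin2004, §5.3] -/
theorem exists_iterate_eq_and_not_mem_range {x : κ.twistTower ρ hM} (hx : x ≠ 0) :
    ∃ (a : ℕ) (y : κ.twistTower ρ hM), (κ.towerShift ρ hM)^[a] y = x ∧
      ∀ z : κ.twistTower ρ hM, κ.towerShift ρ hM z ≠ y := by
  classical
  -- some level `J` with `x J ≠ 0`; then `x ∉ T^[a] 𝐇¹_Ω` for `a ≥ J`
  have hJ : ∃ J, x.1 J ≠ 0 := by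
    by_contra h
    push Not at h
    exact hx (Subtype.ext (funext h))
  obtain ⟨J, hJ⟩ := hJ
  let P : ℕ → Prop := fun a => ∃ y : κ.twistTower ρ hM, (κ.towerShift ρ hM)^[a] y = x
  have hbound : ∀ a, P a → a < J := by
    rintro a ⟨y, hy⟩
    by_contra hle
    push Not at hle
    apply hJ
    rw [← hy, towerShift_iterate_apply_coe]
    exact κ.shiftH1_iterate_eq_zero ρ hM J hle _
  -- the maximal such `a` (`Nat.findGreatest` below the bound `J`)
  have h0 : P 0 := ⟨x, rfl⟩
  have ha : P (Nat.findGreatest P J) := Nat.findGreatest_spec (Nat.zero_le J) h0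
  obtain ⟨y, hy⟩ := ha
  refine ⟨Nat.findGreatest P J, y, hy, fun z hz => ?_⟩
  have hP : P (Nat.findGreatest P J + 1) :=
    ⟨z, by rw [Function.iterate_succ_apply, hz, hy]⟩
  exact Nat.findGreatest_is_greatest (Nat.lt_succ_self _) (hbound _ ⟨y, hy⟩) hP

/-! ## Reduction modulo `T`: `𝐇¹_Ω → H¹(K, M)` -/

/-- **Reduction mod `T`**, `𝐇¹_Ω → H¹(K, M)`: the constant coefficient of the level-`1` component
(`twistModPConstCoeff` at `J = 1`; `𝒯_1 = M`).  MU-TRANSFER-PROOF (F4): "`κ̄' := κ' mod T` in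
`𝐇¹_Ω/T ↪ H¹(G_S, E[p])`". [cite: MazurRubin2004, §5.3] -/
def towerConst : κ.twistTower ρ hM →+ galoisCohomology ρ 1 :=
  (galoisCohomology.map (κ.twistModPConstCoeff ρ hM 1 Nat.one_pos) 1).comp
    ((Pi.evalAddMonoidHom (fun J : ℕ => galoisCohomology (κ.twistModP ρ hM J) 1) 1).comp
      (κ.twistTower ρ hM).subtype)

/-- Unfolding `towerConst`. [cite: MazurRubin2004, §5.3] -/
theorem towerConst_apply (x : κ.twistTower ρ hM) :
    κ.towerConst ρ hM x = galoisCohomology.map (κ.twistModPConstCoeff ρ hM 1 Nat.one_pos) 1 (x.1 1) := rfl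

/-- **`T·𝐇¹_Ω` dies modulo `T`**: `towerConst (T x) = 0` (the constant coefficient of `S y` is `0`).
[cite: MazurRubin2004, §5.3] -/
theorem towerConst_towerShift (x : κ.twistTower ρ hM) : κ.towerConst ρ hM (κ.towerShift ρ hM x) = 0 := by
  rw [towerConst_apply, towerShift_apply_coe, shiftH1]
  obtain ⟨φ, hφ⟩ := oneCocycleClass_surjective _ (x.1 1)
  rw [← hφ, map_oneCocycleClass_twist, map_oneCocycleClass_twist]
  refine (oneCocycleClass_eq_zero_iff _ _).mpr ⟨0, fun σ => ?_⟩
  rw [pushCocycle_apply, pushCocycle_apply, twistModPShift_apply, twistModPConstCoeff_apply,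
    shiftEnd_apply, dif_pos rfl, map_zero, sub_zero]

end ZpExtension

end Literature.NumberTheory.EllipticCurves

end
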